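import Summits.NavierStokesRegularity.FunctionalMining.RateBudgets
import Summits.NavierStokesRegularity.FunctionalMining.StretchingConst
import Literature.Analysis.FunctionSpaces.TorusPlanarLift
import Literature.Analysis.FluidPDE.DEIJShearStage
import HarnessLib

/-!
# K1-Q1 lower side in the kernel: cellular fields, part 1 — plateau profiles

Cell `pub-nsfunc` (host summit NavierStokesRegularity, topic `FunctionalMining`), prove seat gen 5, kernel version
of the bank seat's hand Theorem 1 of `pub-nsfunc-bank/K1Q1-HALF.md` (the 2½-D stretching constant is exactly `½`,
hence `½ ≤ C⋆ = stretchingSupConst`). **Search for candidate a priori estimates; no regularity claim.** Static field facts only; nothing is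
asserted about Navier–Stokes solutions or their regularity.

The cellular family (five files `StretchingLowerCellular*`): `u = (S_ε(x₁), −S_ε(x₀), w(x₀,x₁))` on `T³`, with
`S_ε` the tree's smoothed triangle wave (`S_ε' = w_ε =: q`, EXACT plateaus `q = ±1`), so that the strain of the
crossed-shear base flow lives on the cells `{q(x₀) = −q(x₁)}` (pure strain `s = ±1`, vorticity `0`) and its
vorticity on the cells `{q(x₀) = q(x₁)}` (pure rotation); and
`w = η₊(x₀)η₋(x₁)·H(x₀ + x₁) + η₋(x₀)η₊(x₁)·H(x₀ − x₁)`, envelopes `η_∓` supported INSIDE the plateaus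
`{q = ∓1}`, waves `H = (a/m)S_ε(m·)` aligned with the stretching direction of each strain cell. An exact-plateau
variant of the bank's §2 construction: no Riemann–Lebesgue lemma and no trigonometric orthogonality is needed —
all cross terms carry a factor `1/m` and are bounded by sup norms, and the only oscillatory integral,
`∫(1 − w_ε(m(x₀ ± x₁))²)`, is computed by shear and dilation invariance of Haar measure.

This file: plateau lemmas for `w_ε` (`= 1` on `[−¼ + 2ε, ¼]`, `= −1` on `[¼ + 2ε, ¾]`, `w_ε(y + ½) = −w_ε(y)`),
the shifted profile, the base profile `S_ε`, the envelope `η₋ = ¼(1 − w_ε(· − 2ε))(1 − w_ε(· + 2ε))` (values in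
`[0,1]`, support in `{w_ε = −1}`, `= 1` on `[¼ + 4ε, ¾ − 2ε]`, `|η₋'| ≤ 2C_ψ/ε`), `η₊ = η₋(· + ½)`, and the wave.
-/

noncomputable section

open MeasureTheory Set Filter Topology Function
open scoped InnerProductSpace ContDiff

namespace Summit.NavierStokesRegularity.FunctionalMining

open Literature.Analysis Literature.Analysis.FunctionSpaces Literature.Analysis.FunctionSpaces.Torus
open Literature.Analysis.FluidPDE Literature.Analysis.FluidPDE.Torus

namespace CellularStretching

/-! ## 1. Plateaus of the slope wave `w_ε` -/

/-- `w_ε = 1` where `fract ≤ 1/4`. [folklore] -/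
theorem slopeWave_eq_one_of_fract_le {ε y : ℝ} (hε : 0 < ε) (hy : Int.fract y ≤ 4⁻¹) :
    DEIJ.slopeWave ε y = 1 := by
  have ha : Real.smoothTransition ((Int.fract y - 4⁻¹) / (2 * ε)) = 0 :=
    Real.smoothTransition.zero_of_nonpos (div_nonpos_of_nonpos_of_nonneg (by linarith) (by positivity))
  have hb : Real.smoothTransition ((Int.fract y - 3 / 4) / (2 * ε)) = 0 :=
    Real.smoothTransition.zero_of_nonpos (div_nonpos_of_nonpos_of_nonneg (by linarith) (by positivity))
  rw [DEIJ.slopeWave, ha, hb]; norm_num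

/-- `w_ε = 1` where `3/4 + 2ε ≤ fract`. [folklore] -/
theorem slopeWave_eq_one_of_le_fract {ε y : ℝ} (hε : 0 < ε) (hy : 3 / 4 + 2 * ε ≤ Int.fract y) :
    DEIJ.slopeWave ε y = 1 := by
  have ha : Real.smoothTransition ((Int.fract y - 4⁻¹) / (2 * ε)) = 1 :=
    Real.smoothTransition.one_of_one_le (by rw [le_div_iff₀ (by positivity)]; linarith)
  have hb : Real.smoothTransition ((Int.fract y - 3 / 4) / (2 * ε)) = 1 :=
    Real.smoothTransition.one_of_one_le (by rw [le_div_iff₀ (by positivity)]; linarith)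
  rw [DEIJ.slopeWave, ha, hb]; norm_num

/-- `w_ε = −1` where `1/4 + 2ε ≤ fract ≤ 3/4`. [folklore] -/
theorem slopeWave_eq_neg_one_of_fract_mem {ε y : ℝ} (hε : 0 < ε) (h1 : 4⁻¹ + 2 * ε ≤ Int.fract y)
    (h2 : Int.fract y ≤ 3 / 4) : DEIJ.slopeWave ε y = -1 := by
  have ha : Real.smoothTransition ((Int.fract y - 4⁻¹) / (2 * ε)) = 1 :=
    Real.smoothTransition.one_of_one_le (by rw [le_div_iff₀ (by positivity)]; linarith)
  have hb : Real.smoothTransition ((Int.fract y - 3 / 4) / (2 * ε)) = 0 :=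
    Real.smoothTransition.zero_of_nonpos (div_nonpos_of_nonpos_of_nonneg (by linarith) (by positivity))
  rw [DEIJ.slopeWave, ha, hb]; norm_num

/-- **Plateau `+1` in real form**: `w_ε(y) = 1` whenever `y − k ∈ [−1/4 + 2ε, 1/4]` for some integer `k`.
[folklore] -/
theorem slopeWave_eq_one {ε y : ℝ} (hε : 0 < ε) (hε' : ε ≤ 1 / 16) (k : ℤ)
    (h : y - k ∈ Icc (-4⁻¹ + 2 * ε) 4⁻¹) : DEIJ.slopeWave ε y = 1 := by
  have hper : DEIJ.slopeWave ε y = DEIJ.slopeWave ε (y - k) := by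
    have := (DEIJ.slopeWave_periodic ε).sub_int_mul_eq k (x := y)
    rw [mul_one] at this
    exact this.symm
  rw [hper]
  rcases le_or_gt 0 (y - k) with h0 | h0
  · have hf : Int.fract (y - k) = y - k := Int.fract_eq_self.2 ⟨h0, by linarith [h.2]⟩
    exact slopeWave_eq_one_of_fract_le hε (by rw [hf]; exact h.2)
  · have hf : Int.fract (y - k) = y - k + 1 := by
      rw [Int.fract_eq_iff]
      refine ⟨by linarith [h.1], by linarith, ⟨-1, by push_cast; ring⟩⟩
    exact slopeWave_eq_one_of_le_fract hε (by rw [hf]; linarith [h.1])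

/-- **Plateau `−1` in real form**: `w_ε(y) = −1` whenever `y − k ∈ [1/4 + 2ε, 3/4]` for some integer `k`.
[folklore] -/
theorem slopeWave_eq_neg_one {ε y : ℝ} (hε : 0 < ε) (k : ℤ)
    (h : y - k ∈ Icc (4⁻¹ + 2 * ε) (3 / 4)) : DEIJ.slopeWave ε y = -1 := by
  have hper : DEIJ.slopeWave ε y = DEIJ.slopeWave ε (y - k) := by
    have := (DEIJ.slopeWave_periodic ε).sub_int_mul_eq k (x := y)
    rw [mul_one] at this
    exact this.symm
  rw [hper]
  have hf : Int.fract (y - k) = y - k := Int.fract_eq_self.2 ⟨by linarith [h.1], by linarith [h.2]⟩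
  exact slopeWave_eq_neg_one_of_fract_mem hε (by rw [hf]; exact h.1) (by rw [hf]; exact h.2)

/-- **Half-period antisymmetry**: `w_ε(y + 1/2) = −w_ε(y)` (`0 < ε ≤ 1/16`). [folklore] -/
theorem slopeWave_add_half {ε : ℝ} (hε : 0 < ε) (hε' : ε ≤ 1 / 16) (y : ℝ) :
    DEIJ.slopeWave ε (y + 2⁻¹) = -DEIJ.slopeWave ε y := by
  have hf0 : 0 ≤ Int.fract y := Int.fract_nonneg y
  have hf1 : Int.fract y < 1 := Int.fract_lt_one y
  have hyf : y - Int.fract y = ⌊y⌋ := Int.self_sub_fract y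
  rcases lt_or_ge (Int.fract y) 2⁻¹ with h | h
  · have hfr : Int.fract (y + 2⁻¹) = Int.fract y + 2⁻¹ := by
      rw [Int.fract_eq_iff]
      exact ⟨by linarith, by linarith, ⟨⌊y⌋, by linarith⟩⟩
    have h1 : Real.smoothTransition ((Int.fract y + 2⁻¹ - 4⁻¹) / (2 * ε)) = 1 :=
      Real.smoothTransition.one_of_one_le (by rw [le_div_iff₀ (by positivity)]; linarith)
    have h2 : Real.smoothTransition ((Int.fract y - 3 / 4) / (2 * ε)) = 0 :=
      Real.smoothTransition.zero_of_nonpos (div_nonpos_of_nonpos_of_nonneg (by linarith) (by positivity))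
    have h3 : (Int.fract y + 2⁻¹ - 3 / 4) / (2 * ε) = (Int.fract y - 4⁻¹) / (2 * ε) := by ring
    rw [DEIJ.slopeWave, DEIJ.slopeWave, hfr, h1, h2, h3]
    ring
  · have hfr : Int.fract (y + 2⁻¹) = Int.fract y - 2⁻¹ := by
      rw [Int.fract_eq_iff]
      exact ⟨by linarith, by linarith, ⟨⌊y⌋ + 1, by push_cast; linarith⟩⟩
    have h1 : Real.smoothTransition ((Int.fract y - 4⁻¹) / (2 * ε)) = 1 :=
      Real.smoothTransition.one_of_one_le (by rw [le_div_iff₀ (by positivity)]; linarith)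
    have h2 : Real.smoothTransition ((Int.fract y - 2⁻¹ - 3 / 4) / (2 * ε)) = 0 :=
      Real.smoothTransition.zero_of_nonpos (div_nonpos_of_nonpos_of_nonneg (by linarith) (by positivity))
    have h3 : (Int.fract y - 2⁻¹ - 4⁻¹) / (2 * ε) = (Int.fract y - 3 / 4) / (2 * ε) := by ring
    rw [DEIJ.slopeWave, DEIJ.slopeWave, hfr, h1, h2, h3]
    ring


/-! ## 2. The profiles: base `S_ε`, envelopes `η₋`, `η₊ = η₋(· + ½)`, wave `(a/m)·S_ε(m·)` -/

/-- `ε ≤ 1/32` implies the tree's standing hypothesis `ε ≤ 1/16` for `w_ε`. [folklore] -/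
theorem le_sixteenth {ε : ℝ} (h : ε ≤ 1 / 32) : ε ≤ 1 / 16 := h.trans (by norm_num)

/-- **Shift of a profile**: `t ↦ P(t + c)`. [folklore] -/
def shift (P : ShearProfile) (c : ℝ) : ShearProfile where
  toFun t := P (t + c)
  periodic' t := by
    show P (t + 1 + c) = P (t + c)
    rw [add_right_comm]; exact P.periodic (t + c)
  contDiff' := P.contDiff.comp (contDiff_id.add contDiff_const)

/-- Values of the shifted profile. [folklore] -/
@[simp] theorem shift_apply (P : ShearProfile) (c t : ℝ) : shift P c t = P (t + c) := rfl

/-- Derivative of the shifted profile. [folklore] -/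
theorem deriv_shift (P : ShearProfile) (c t : ℝ) : deriv (shift P c) t = deriv P (t + c) := by
  have h : HasDerivAt (fun s => P (s + c)) (deriv P (t + c)) t :=
    HasDerivAt.comp_add_const t c ((P.contDiff.differentiable (by simp)) (t + c)).hasDerivAt
  exact h.deriv

/-- A profile has derivative `deriv P` everywhere. [folklore] -/
theorem hasDerivAt_profile (P : ShearProfile) (t : ℝ) : HasDerivAt P (deriv P t) t :=
  ((P.contDiff.differentiable (by simp)) t).hasDerivAt

section Profiles

variable {ε : ℝ} (hε : 0 < ε) (hε' : ε ≤ 1 / 32)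

/-- **The base profile** `S_ε` (the tree's stage profile with amplitude `1`, frequency `1`, phase `0`):
`S_ε' = w_ε`. [ours; bookkeeping] -/
def base (hε : 0 < ε) (hε' : ε ≤ 1 / 32) : ShearProfile :=
  DEIJ.stageProfile ε hε (le_sixteenth hε') 1 1 0

/-- `S_ε' = w_ε`. [folklore] -/
theorem deriv_base : deriv (base hε hε') = DEIJ.slopeWave ε := by
  rw [base, DEIJ.deriv_stageProfile]; funext y; simp

/-- `|S_ε'| ≤ 1`. [folklore] -/
theorem abs_deriv_base_le (t : ℝ) : |deriv (base hε hε') t| ≤ 1 := by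
  rw [deriv_base]; exact DEIJ.abs_slopeWave_le hε (le_sixteenth hε') t

/-- **The envelope** `η₋(t) = ¼(1 − w_ε(t − 2ε))(1 − w_ε(t + 2ε))`: values in `[0,1]`, supported inside the
plateau `{w_ε = −1}`, equal to `1` on `[1/4 + 4ε, 3/4 − 2ε]`. [ours] -/
def envM (hε : 0 < ε) (hε' : ε ≤ 1 / 32) : ShearProfile where
  toFun t := (1 - DEIJ.slopeWave ε (t - 2 * ε)) / 2 * ((1 - DEIJ.slopeWave ε (t + 2 * ε)) / 2)
  periodic' t := by
    show (1 - DEIJ.slopeWave ε (t + 1 - 2 * ε)) / 2 * ((1 - DEIJ.slopeWave ε (t + 1 + 2 * ε)) / 2) =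
      (1 - DEIJ.slopeWave ε (t - 2 * ε)) / 2 * ((1 - DEIJ.slopeWave ε (t + 2 * ε)) / 2)
    rw [show t + 1 - 2 * ε = (t - 2 * ε) + 1 by ring, show t + 1 + 2 * ε = (t + 2 * ε) + 1 by ring,
      DEIJ.slopeWave_periodic ε, DEIJ.slopeWave_periodic ε]
  contDiff' := by
    have hq := DEIJ.contDiff_slopeWave hε (le_sixteenth hε')
    exact ((contDiff_const.sub (hq.comp (contDiff_id.sub contDiff_const))).div_const _).mul
      ((contDiff_const.sub (hq.comp (contDiff_id.add contDiff_const))).div_const _)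

/-- Values of `η₋`. [ours; bookkeeping] -/
theorem envM_apply (t : ℝ) : envM hε hε' t =
    (1 - DEIJ.slopeWave ε (t - 2 * ε)) / 2 * ((1 - DEIJ.slopeWave ε (t + 2 * ε)) / 2) := rfl

/-- `0 ≤ η₋ ≤ 1`. [ours; elementary] -/
theorem envM_mem (t : ℝ) : envM hε hε' t ∈ Icc (0 : ℝ) 1 := by
  rw [envM_apply]
  have h1 := abs_le.1 (DEIJ.abs_slopeWave_le hε (le_sixteenth hε') (t - 2 * ε))
  have h2 := abs_le.1 (DEIJ.abs_slopeWave_le hε (le_sixteenth hε') (t + 2 * ε))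
  constructor
  · exact mul_nonneg (by linarith) (by linarith)
  · nlinarith

/-- **Support of `η₋`**: off the plateau `{w_ε = −1}` the envelope vanishes. [ours; elementary] -/
theorem envM_eq_zero {t : ℝ} (ht : DEIJ.slopeWave ε t ≠ -1) : envM hε hε' t = 0 := by
  have h16 := le_sixteenth hε'
  have hf0 : 0 ≤ Int.fract t := Int.fract_nonneg t
  have hf1 : Int.fract t < 1 := Int.fract_lt_one t
  have htf : t = ⌊t⌋ + Int.fract t := (Int.floor_add_fract t).symm
  -- `fract t ∉ [1/4 + 2ε, 3/4]`
  have hcase : Int.fract t < 4⁻¹ + 2 * ε ∨ 3 / 4 < Int.fract t := by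
    by_contra h
    simp only [not_or, not_lt] at h
    exact ht (slopeWave_eq_neg_one_of_fract_mem hε h.1 h.2)
  rw [envM_apply]
  rcases hcase with h | h
  · have h1 : DEIJ.slopeWave ε (t - 2 * ε) = 1 :=
      slopeWave_eq_one hε h16 ⌊t⌋ ⟨by linarith, by linarith⟩
    rw [h1]; ring
  · have h1 : DEIJ.slopeWave ε (t + 2 * ε) = 1 :=
      slopeWave_eq_one hε h16 (⌊t⌋ + 1) ⟨by push_cast; linarith, by push_cast; linarith⟩
    rw [h1]; ring

/-- **Plateau of `η₋`**: `η₋ = 1` where `fract ∈ [1/4 + 4ε, 3/4 − 2ε]`. [ours; elementary] -/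
theorem envM_eq_one {t : ℝ} (h1 : 4⁻¹ + 4 * ε ≤ Int.fract t) (h2 : Int.fract t ≤ 3 / 4 - 2 * ε) :
    envM hε hε' t = 1 := by
  have htf : t = ⌊t⌋ + Int.fract t := (Int.floor_add_fract t).symm
  have ha : DEIJ.slopeWave ε (t - 2 * ε) = -1 :=
    slopeWave_eq_neg_one hε ⌊t⌋ ⟨by linarith, by linarith⟩
  have hb : DEIJ.slopeWave ε (t + 2 * ε) = -1 :=
    slopeWave_eq_neg_one hε ⌊t⌋ ⟨by linarith, by linarith⟩
  rw [envM_apply, ha, hb]; norm_num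

/-- **The derivative of `η₋`.** [ours; elementary] -/
theorem hasDerivAt_envM (t : ℝ) : HasDerivAt (envM hε hε')
    (-deriv (DEIJ.slopeWave ε) (t - 2 * ε) / 2 * ((1 - DEIJ.slopeWave ε (t + 2 * ε)) / 2) +
      (1 - DEIJ.slopeWave ε (t - 2 * ε)) / 2 * (-deriv (DEIJ.slopeWave ε) (t + 2 * ε) / 2)) t := by
  have hq : ∀ s, HasDerivAt (DEIJ.slopeWave ε) (deriv (DEIJ.slopeWave ε) s) s := fun s =>
    (((DEIJ.contDiff_slopeWave hε (le_sixteenth hε')).differentiable (by simp)) s).hasDerivAt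
  have h1 : HasDerivAt (fun s => (1 - DEIJ.slopeWave ε (s - 2 * ε)) / 2)
      (-deriv (DEIJ.slopeWave ε) (t - 2 * ε) / 2) t := by
    have := ((HasDerivAt.comp_sub_const t (2 * ε) (hq (t - 2 * ε))).const_sub 1).div_const 2
    simpa using this
  have h2 : HasDerivAt (fun s => (1 - DEIJ.slopeWave ε (s + 2 * ε)) / 2)
      (-deriv (DEIJ.slopeWave ε) (t + 2 * ε) / 2) t := by
    have := ((HasDerivAt.comp_add_const t (2 * ε) (hq (t + 2 * ε))).const_sub 1).div_const 2
    simpa using this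
  exact h1.mul h2

/-- **`|η₋'| ≤ 2C_ψ/ε`.** [ours; elementary] -/
theorem abs_deriv_envM_le (t : ℝ) : |deriv (envM hε hε') t| ≤ 2 * ShearCascade.Cψ1 / ε := by
  have h16 := le_sixteenth hε'
  rw [(hasDerivAt_envM hε hε' t).deriv]
  set Λ := 2 * ShearCascade.Cψ1 / ε
  have hΛ : 0 ≤ Λ := by
    have := DEIJ.abs_deriv_slopeWave_le hε h16 0
    exact (abs_nonneg _).trans this
  have hd1 := abs_le.1 (DEIJ.abs_deriv_slopeWave_le hε h16 (t - 2 * ε))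
  have hd2 := abs_le.1 (DEIJ.abs_deriv_slopeWave_le hε h16 (t + 2 * ε))
  have hq1 := abs_le.1 (DEIJ.abs_slopeWave_le hε h16 (t - 2 * ε))
  have hq2 := abs_le.1 (DEIJ.abs_slopeWave_le hε h16 (t + 2 * ε))
  rw [abs_le]
  constructor
  · nlinarith
  · nlinarith

/-- Where `η₋` vanishes so does `η₋'` (a minimum of a nonnegative function). [ours; elementary] -/
theorem deriv_envM_eq_zero {t : ℝ} (h : envM hε hε' t = 0) : deriv (envM hε hε') t = 0 :=
  IsLocalMin.deriv_eq_zero (Filter.Eventually.of_forall fun s => by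
    rw [h]; exact (envM_mem hε hε' s).1)

/-- **The envelope `η₊ := η₋(· + ½)`**, supported inside the plateau `{w_ε = +1}`. [ours] -/
def envP (hε : 0 < ε) (hε' : ε ≤ 1 / 32) : ShearProfile := shift (envM hε hε') 2⁻¹

/-- `0 ≤ η₊ ≤ 1`. [ours; elementary] -/
theorem envP_mem (t : ℝ) : envP hε hε' t ∈ Icc (0 : ℝ) 1 := envM_mem hε hε' (t + 2⁻¹)

/-- **Support of `η₊`**: off the plateau `{w_ε = 1}` it vanishes (`w_ε(t + ½) = −w_ε(t)`). [ours; elementary] -/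
theorem envP_eq_zero {t : ℝ} (ht : DEIJ.slopeWave ε t ≠ 1) : envP hε hε' t = 0 := by
  refine envM_eq_zero hε hε' (t := t + 2⁻¹) ?_
  rw [slopeWave_add_half hε (le_sixteenth hε')]
  intro h; exact ht (by linarith)

/-- `|η₊'| ≤ 2C_ψ/ε`. [ours; elementary] -/
theorem abs_deriv_envP_le (t : ℝ) : |deriv (envP hε hε') t| ≤ 2 * ShearCascade.Cψ1 / ε := by
  rw [envP, deriv_shift]; exact abs_deriv_envM_le hε hε' _

/-- Where `η₊` vanishes so does `η₊'`. [ours; elementary] -/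
theorem deriv_envP_eq_zero {t : ℝ} (h : envP hε hε' t = 0) : deriv (envP hε hε') t = 0 :=
  IsLocalMin.deriv_eq_zero (Filter.Eventually.of_forall fun s => by
    rw [h]; exact (envP_mem hε hε' s).1)

/-- **The wave** `H(t) = (a/m)·S_ε(mt)` (tree stage profile, frequency `m`, amplitude `a/m`). [ours; bookkeeping] -/
def wave (hε : 0 < ε) (hε' : ε ≤ 1 / 32) (m : ℕ) (a : ℝ) : ShearProfile :=
  DEIJ.stageProfile ε hε (le_sixteenth hε') m (a / m) 0

/-- `|H| ≤ |a|/m`. [folklore] -/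
theorem abs_wave_le (m : ℕ) (a t : ℝ) : |wave hε hε' m a t| ≤ |a / m| :=
  DEIJ.abs_stageProfile_le hε (le_sixteenth hε') m (a / m) 0 t

/-- `H'(t) = a·w_ε(mt)` (`m ≠ 0`). [folklore] -/
theorem deriv_wave {m : ℕ} (hm : m ≠ 0) (a : ℝ) :
    deriv (wave hε hε' m a) = fun t => a * DEIJ.slopeWave ε (m * t) := by
  rw [wave, DEIJ.deriv_stageProfile]
  funext t
  have hm' : (m : ℝ) ≠ 0 := Nat.cast_ne_zero.2 hm
  rw [add_zero]; field_simp

/-- `|H'| ≤ |a|`. [folklore] -/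
theorem abs_deriv_wave_le (m : ℕ) (a t : ℝ) : |deriv (wave hε hε' m a) t| ≤ |a| := by
  rcases eq_or_ne m 0 with hm | hm
  · subst hm
    rw [wave, DEIJ.deriv_stageProfile]
    simp
  · rw [deriv_wave hε hε' hm, abs_mul]
    exact mul_le_of_le_one_right (abs_nonneg _) (DEIJ.abs_slopeWave_le hε (le_sixteenth hε') _)

/-- **`H'(t)² = a² − a²(1 − w_ε(mt)²)`** (`m ≠ 0`): the slack `1 − w_ε²` has small mean. [folklore] -/
theorem deriv_wave_sq {m : ℕ} (hm : m ≠ 0) (a t : ℝ) :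
    deriv (wave hε hε' m a) t ^ 2 = a ^ 2 - a ^ 2 * (1 - DEIJ.slopeWave ε (m * t) ^ 2) := by
  rw [deriv_wave hε hε' hm]; ring

end Profiles

end CellularStretching

end Summit.NavierStokesRegularity.FunctionalMining

end
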